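import Summits.HodgeConjecture.CorCM.Census.TwoAdicSplitting

/-!
# Two-adic splitting RELATIVE to a `2`-subgroup: `G = P·N` — the `2`-adic closing faces are free modulo the `N`-coboundaries

COR-CM (cell `pub-hodgecm2`), count-neutral kernel combinatorics by the binder seat b09 (gen 40; lane RELATIVE SPLITTING), sequel of
`Census/CoinvariantTwoGroups.lean` (gen 29: `p`-group Nakayama `eq_of_le_sup_aug`, `hodge2_le_of_isPGroup`), `Census/TwoAdicSplitting.lean`
(gen 38: `exists_faces_extension`, `exists_generate_extension_of_isPGroup`) and seat b23ʼs `Census/OddIndexGeneration.lean`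
(`exists_odd_smul_mem_of_hodge2_le`, `generate_of_odd_smul_of_two_pow_smul`), all used BY NAME.  Theorems only: no definition, no `decide`,
no certificate, no named fact, no `sorry`.
HONEST FRAMING: `HC_CM` is NOT proved, here or anywhere in the tree; nothing here is a period or a headline.

WHY.  Every splitting theorem of the lane so far (`Coinvariant.hodge2_le_of_isPGroup`, `Splitting.exists_generate_extension_of_isPGroup`, the
META theorem `Splitting.isLeast_card_gfaces_generate_of_reduction`) asks `G` to be a `2`-GROUP: then the augmentation ideal of `𝔽₂[G]` is
nilpotent and a face family spanning the coinvariant fibre `hodge2 / rad2` generates mod `2` (Nakayama), so the `2`-adic closing of a law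
`μ(G,c) = φ₂(G,c)` is free.  For the Galois groups of most CM fields this fails as stated (`ℤ/12`, `ℤ/6 × ℤ/2`, `Dic₃`: gen 29ʼs numerics found
fibre-spanning families of `φ₂` faces that do NOT generate), and the quaternion column `Q_{4n}` is closed only for `n = 2^m`
(`Census/QuaternionColumnPivot.lean`, gen 39: «general even `n` needs `IsPGroup` dropped from META»).  This file drops it: the price is explicit and
exact.

THE SETTING.  `G` finite, `c` a central involution, and a FACTORISATION `G = ι(Γ)·⟨N⟩`: `Γ` a `2`-group with a homomorphism `ι : Γ → G` and
`N ⊆ G` any set of elements such that every `Q ∈ G` is `ι(γ)·n` with `n` in the subgroup generated by `N` (e.g. `Γ` a Sylow `2`-subgroup and `N`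
generators of a normal `2`-complement: all `2`-nilpotent groups — `ℤ/2^a m`, `Q_{4n}`, `Dic(A)`, `ℤ/m ⋊ ℤ/2^k`, `P × B`; but also `Γ = Q₈`,
`N = ` a `3`-cycle in `SL₂(𝔽₃)`: normality of `⟨N⟩` is never used).  The TARGET of a family `S` is `T(S) = pair2 + 𝔽₂⟨base changes of S⟩`.

**THEOREM A (`hodge2_le_of_isPGroup_rel`, mod `2`).**  If `S ⊆ hodge2` spans the coinvariant fibre (`hodge2 ≤ rad2 + 𝔽₂⟨S⟩`) AND the
`N`-COBOUNDARIES OF THE FACES lie in the target (`f·n⁻¹ − f ∈ T(S)` for every face `f` mod `2` and every `n ∈ N`), then `S` generates: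
`hodge2 ≤ T(S)`.  Both hypotheses are also necessary (`cobdry_mem_of_hodge2_le`, `le_rad2_sup_of_hodge2_le`), so for a factorised group the
`N`-coboundary condition is EXACTLY the defect between «spans the fibre» and «generates mod 2».  Proof: Nakayama for the `2`-group `Γ` acting
through `ι`; a `G`-coboundary `x·(ι(γ)n)⁻¹ − x` of a Hodge vector splits as the `Γ`-coboundary of `x·n⁻¹` plus the `N`-coboundary `x·n⁻¹ − x`,
and the coboundary condition passes from faces to all Hodge vectors mod `2` (linearity, pairs are stable) and from `N` to the subgroup it
generates (cocycle identity).  With `N = ∅` and `ι = id` this is gen 29ʼs `hodge2_le_of_isPGroup`.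

**THEOREM B (`hodgeSpan_le_of_isPGroup_rel`, `exists_generate_extension_of_isPGroup_rel`, `isLeast_card_gfaces_generate_of_isPGroup_rel`,
integral).**  Under the same factorisation: a fibre-independent face family `S₀` whose target contains the `N`-coboundaries of all faces mod `2`
and which generates after inverting `2` (`2^k · hodgeSpan ⊆ ℤ⟨pairs⟩ + ℤ[G]·S₀`) extends by free fibre-completing faces to EXACTLY `φ₂(G,c)` faces
generating `hodgeSpan` modulo pairs; hence `μ(G,c) = φ₂(G,c)`.  (The coboundary condition is monotone in the family, so it survives the completion;
then Theorem A, b23ʼs odd lifting and Bézout.)  `red_cobdry_mem_of_sub_two_smul` turns an integral witness `f·n⁻¹ − f − 2z ∈ ℤ⟨pairs⟩ + ℤ[G]·S₀`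
into the mod-`2` hypothesis.  The relative META theorem (nondegenerate base type + residual reduction) is the sequel
`Census/NondegenerateSplittingRelative.lean`.

## References
* [Pohlmann1968] H. Pohlmann, Algebraic cycles on abelian varieties of complex multiplication type, Ann. of Math. 88 (1968), Thm 1.
* [Milne1999] J. S. Milne, Lefschetz motives and the Tate conjecture, Compositio Math. 117 (1999), Prop. 2.1, p. 54.
-/

namespace Summit.HodgeConjecture.CorCM.Census.Splitting

open Finset
open Summit.HodgeConjecture.CorCM.Prior.AllgGroup.RfwfAllgGroup
open Summit.HodgeConjecture.CorCM.Census.BlockParity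
open Summit.HodgeConjecture.CorCM.Census.Coinvariant
open Summit.HodgeConjecture.CorCM.Census.OddIndex

noncomputable section

variable {G : Type*} [Group G] [Fintype G] [DecidableEq G] (c : G)

/-! ## §1 The target mod `2` and the coboundary condition: stability, faces suffice, generators of `N` suffice -/

/-- The target `pair2 + 𝔽₂⟨base changes of S⟩` is base-change stable (central `c`). [folklore] -/
theorem mapDomain_rt_mem_psp2 (hcen : ∀ x : G, x * c = c * x) (S : Finset (CMF G c →₀ ZMod 2)) (Q : G)
    {t : CMF G c →₀ ZMod 2} (ht : t ∈ pair2 c ⊔ Submodule.span (ZMod 2) (translates2 c S)) :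
    Finsupp.mapDomain (rt c Q) t ∈ pair2 c ⊔ Submodule.span (ZMod 2) (translates2 c S) := by
  obtain ⟨q, hq, z, hz, rfl⟩ := Submodule.mem_sup.mp ht
  rw [Finsupp.mapDomain_add]
  exact Submodule.add_mem _ (Submodule.mem_sup_left (mapDomain_rt_mem_pair2 c hcen Q hq))
    (Submodule.mem_sup_right (mapDomain_rt_mem_span_translates2 c Q S hz))

/-- The target contains the family and lies in `hodge2` when the family does. [folklore] -/
theorem psp2_le_hodge2 (hc2 : c * c = 1) (hcen : ∀ x : G, x * c = c * x) (S : Finset (CMF G c →₀ ZMod 2))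
    (hS : (S : Set (CMF G c →₀ ZMod 2)) ⊆ hodge2 c hc2) :
    pair2 c ⊔ Submodule.span (ZMod 2) (translates2 c S) ≤ hodge2 c hc2 :=
  sup_le le_sup_right (span_translates2_le_hodge2 c hc2 hcen S hS)

/-- **Faces suffice.**  If the `n`-coboundary `f·n⁻¹ − f` of every FACE mod `2` lies in the target, so does the `n`-coboundary of every Hodge
vector mod `2` (the coboundary map is linear, `hodge2 = face2 + pair2`, and pairs are base-change stable). [folklore] -/
theorem cobdry_mem_of_faces (hc2 : c * c = 1) (hcen : ∀ x : G, x * c = c * x) (S : Finset (CMF G c →₀ ZMod 2)) {n : G}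
    (hn : ∀ f ∈ faces2 c hc2, Finsupp.mapDomain (rt c n) f - f ∈ pair2 c ⊔ Submodule.span (ZMod 2) (translates2 c S)) :
    ∀ x ∈ hodge2 c hc2, Finsupp.mapDomain (rt c n) x - x ∈ pair2 c ⊔ Submodule.span (ZMod 2) (translates2 c S) := by
  intro x hx
  set D : (CMF G c →₀ ZMod 2) →ₗ[ZMod 2] (CMF G c →₀ ZMod 2) :=
    Finsupp.lmapDomain (ZMod 2) (ZMod 2) (rt c n) - LinearMap.id with hD
  have hDx : ∀ y : CMF G c →₀ ZMod 2, D y = Finsupp.mapDomain (rt c n) y - y := fun y => by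
    rw [hD, LinearMap.sub_apply, Finsupp.lmapDomain_apply, LinearMap.id_apply]
  have hle : hodge2 c hc2 ≤ Submodule.comap D (pair2 c ⊔ Submodule.span (ZMod 2) (translates2 c S)) := by
    rw [hodge2]
    refine sup_le ?_ ?_
    · rw [face2, Submodule.span_le]
      intro f hf
      rw [SetLike.mem_coe, Submodule.mem_comap, hDx]
      exact hn f hf
    · intro q hq
      rw [Submodule.mem_comap, hDx]
      exact Submodule.sub_mem _ (Submodule.mem_sup_left (mapDomain_rt_mem_pair2 c hcen n hq)) (Submodule.mem_sup_left hq)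
  have h := hle hx
  rw [Submodule.mem_comap, hDx] at h
  exact h

/-- **Generators of `N` suffice** (cocycle identity `x·(nn')⁻¹ − x = ((x·n'⁻¹)·n⁻¹ − x·n'⁻¹) + (x·n'⁻¹ − x)`, and
`x·n − x = −((x·n)·n⁻¹ − x·n)`): the coboundary condition on `hodge2` for the members of `N` gives it for the subgroup `N` generates. [folklore] -/
theorem cobdry_mem_of_mem_closure (hc2 : c * c = 1) (hcen : ∀ x : G, x * c = c * x) (S : Finset (CMF G c →₀ ZMod 2)) (N : Set G)
    (hN : ∀ n ∈ N, ∀ x ∈ hodge2 c hc2,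
      Finsupp.mapDomain (rt c n) x - x ∈ pair2 c ⊔ Submodule.span (ZMod 2) (translates2 c S))
    {n : G} (hn : n ∈ Subgroup.closure N) :
    ∀ x ∈ hodge2 c hc2, Finsupp.mapDomain (rt c n) x - x ∈ pair2 c ⊔ Submodule.span (ZMod 2) (translates2 c S) := by
  induction hn using Subgroup.closure_induction with
  | mem n hn => exact hN n hn
  | one =>
    intro x _
    rw [mapDomain_rt_one, sub_self]
    exact Submodule.zero_mem _
  | mul n n' _ _ hn hn' =>
    intro x hx
    have e : Finsupp.mapDomain (rt c (n * n')) x - x =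
        (Finsupp.mapDomain (rt c n) (Finsupp.mapDomain (rt c n') x) - Finsupp.mapDomain (rt c n') x) +
          (Finsupp.mapDomain (rt c n') x - x) := by
      rw [mapDomain_rt_mul]; abel
    rw [e]
    exact Submodule.add_mem _ (hn _ (mapDomain_rt_mem_hodge2 c hc2 hcen n' hx)) (hn' x hx)
  | inv n _ hn =>
    intro x hx
    have e : Finsupp.mapDomain (rt c n⁻¹) x - x =
        -(Finsupp.mapDomain (rt c n) (Finsupp.mapDomain (rt c n⁻¹) x) - Finsupp.mapDomain (rt c n⁻¹) x) := by
      rw [← mapDomain_rt_mul, mul_inv_cancel, mapDomain_rt_one]; abel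
    rw [e]
    exact Submodule.neg_mem _ (hn _ (mapDomain_rt_mem_hodge2 c hc2 hcen n⁻¹ hx))

/-- NECESSITY of the coboundary condition: if `S` generates mod `2`, every coboundary of every Hodge vector mod `2` lies in the target. [folklore] -/
theorem cobdry_mem_of_hodge2_le (hc2 : c * c = 1) (hcen : ∀ x : G, x * c = c * x) (S : Finset (CMF G c →₀ ZMod 2))
    (hgen : hodge2 c hc2 ≤ pair2 c ⊔ Submodule.span (ZMod 2) (translates2 c S)) (n : G) :
    ∀ x ∈ hodge2 c hc2, Finsupp.mapDomain (rt c n) x - x ∈ pair2 c ⊔ Submodule.span (ZMod 2) (translates2 c S) :=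
  fun _ hx => Submodule.sub_mem _ (mapDomain_rt_mem_psp2 c hcen S n (hgen hx)) (hgen hx)

/-- NECESSITY of the fibre condition: if `S ⊆ hodge2` generates mod `2`, it spans the coinvariant fibre (any `G`). [folklore] -/
theorem le_rad2_sup_of_hodge2_le (hc2 : c * c = 1) (hcen : ∀ x : G, x * c = c * x) (S : Finset (CMF G c →₀ ZMod 2))
    (hS : (S : Set (CMF G c →₀ ZMod 2)) ⊆ hodge2 c hc2)
    (hgen : hodge2 c hc2 ≤ pair2 c ⊔ Submodule.span (ZMod 2) (translates2 c S)) :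
    hodge2 c hc2 ≤ rad2 c hc2 ⊔ Submodule.span (ZMod 2) (S : Set (CMF G c →₀ ZMod 2)) := by
  refine hgen.trans (sup_le ((pair2_le_rad2 c hc2).trans le_sup_left) ?_)
  rw [Submodule.span_le]
  rintro _ ⟨Q, s, hs, rfl⟩
  have e : Finsupp.mapDomain (rt c Q) s = (Finsupp.mapDomain (rt c Q) s - s) + s := by abel
  rw [SetLike.mem_coe, e]
  exact Submodule.add_mem _ (Submodule.mem_sup_left (mapDomain_rt_sub_mem_rad2 c hc2 hcen Q (hS hs)))
    (Submodule.mem_sup_right (Submodule.subset_span hs))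

/-! ## §2 THEOREM A: relative Nakayama — fibre-spanning + `N`-coboundaries ⟹ generation mod `2` -/

section Rel

variable {Γ : Type*} [Group Γ]

/-- **RELATIVE TWO-ADIC SPLITTING, mod `2`.**  `G = ι(Γ)·⟨N⟩` with `Γ` a `2`-group; `c` central.  A family `S ⊆ hodge2` which spans the
coinvariant fibre (`hodge2 ≤ rad2 + 𝔽₂⟨S⟩`) and whose target contains the `N`-coboundaries `f·n⁻¹ − f` of all faces mod `2` GENERATES:
`hodge2 ≤ pair2 + 𝔽₂⟨base changes of S⟩`.  (`N = ∅`, `ι = id`: gen 29ʼs `hodge2_le_of_isPGroup`.) [folklore] -/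
theorem hodge2_le_of_isPGroup_rel (hΓ : IsPGroup 2 Γ) (ι : Γ →* G) (N : Set G)
    (hcov : ∀ Q : G, ∃ γ : Γ, ∃ n ∈ Subgroup.closure N, Q = ι γ * n)
    (hc2 : c * c = 1) (hcen : ∀ x : G, x * c = c * x)
    (S : Finset (CMF G c →₀ ZMod 2)) (hS : (S : Set (CMF G c →₀ ZMod 2)) ⊆ hodge2 c hc2)
    (h : hodge2 c hc2 ≤ rad2 c hc2 ⊔ Submodule.span (ZMod 2) (S : Set (CMF G c →₀ ZMod 2)))
    (hN : ∀ n ∈ N, ∀ f ∈ faces2 c hc2,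
      Finsupp.mapDomain (rt c n) f - f ∈ pair2 c ⊔ Submodule.span (ZMod 2) (translates2 c S)) :
    hodge2 c hc2 ≤ pair2 c ⊔ Submodule.span (ZMod 2) (translates2 c S) := by
  set T := pair2 c ⊔ Submodule.span (ZMod 2) (translates2 c S) with hTdef
  set ρ : Γ → (CMF G c →₀ ZMod 2) →ₗ[ZMod 2] (CMF G c →₀ ZMod 2) :=
    fun γ => Finsupp.lmapDomain (ZMod 2) (ZMod 2) (rt c (ι γ)) with hρ
  have ρ_apply : ∀ (γ : Γ) (x : CMF G c →₀ ZMod 2), ρ γ x = Finsupp.mapDomain (rt c (ι γ)) x := fun γ x => rfl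
  have ρ_one : ρ 1 = LinearMap.id := by
    rw [hρ]
    show Finsupp.lmapDomain (ZMod 2) (ZMod 2) (rt c (ι 1)) = LinearMap.id
    rw [map_one]
    exact lmapDomain_rt_one c
  have ρ_mul : ∀ γ γ' : Γ, ρ (γ * γ') = ρ γ ∘ₗ ρ γ' := fun γ γ' => by
    rw [hρ]
    show Finsupp.lmapDomain (ZMod 2) (ZMod 2) (rt c (ι (γ * γ'))) =
      Finsupp.lmapDomain (ZMod 2) (ZMod 2) (rt c (ι γ)) ∘ₗ Finsupp.lmapDomain (ZMod 2) (ZMod 2) (rt c (ι γ'))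
    rw [map_mul]
    exact lmapDomain_rt_mul c _ _
  have hT : ∀ γ : Γ, ∀ t ∈ T, ρ γ t ∈ T := fun γ t ht => by
    rw [ρ_apply]; exact mapDomain_rt_mem_psp2 c hcen S (ι γ) ht
  have hU : ∀ γ : Γ, ∀ u ∈ hodge2 c hc2, ρ γ u ∈ hodge2 c hc2 := fun γ u hu => by
    rw [ρ_apply]; exact mapDomain_rt_mem_hodge2 c hc2 hcen (ι γ) hu
  have hTU : T ≤ hodge2 c hc2 := psp2_le_hodge2 c hc2 hcen S hS
  -- the coboundary condition on all of `hodge2` and on the whole subgroup generated by `N`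
  have hN' : ∀ n ∈ Subgroup.closure N, ∀ x ∈ hodge2 c hc2, Finsupp.mapDomain (rt c n) x - x ∈ T :=
    fun n hn => cobdry_mem_of_mem_closure c hc2 hcen S N (fun n' hn' => cobdry_mem_of_faces c hc2 hcen S (hN n' hn')) hn
  have haug : hodge2 c hc2 ≤ T ⊔ Submodule.span (ZMod 2) {w | ∃ γ : Γ, ∃ u ∈ hodge2 c hc2, w = ρ γ u - u} := by
    refine h.trans (sup_le (sup_le ?_ ?_) ?_)
    · exact (le_sup_left : pair2 c ≤ T).trans le_sup_left
    · rw [aug2, Submodule.span_le]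
      rintro _ ⟨Q, x, hx, rfl⟩
      obtain ⟨γ, n, hn, rfl⟩ := hcov Q
      have hxU : x ∈ hodge2 c hc2 := le_sup_left (b := pair2 c) (Submodule.subset_span hx)
      have hxn : Finsupp.mapDomain (rt c n) x ∈ hodge2 c hc2 := mapDomain_rt_mem_hodge2 c hc2 hcen n hxU
      have e : Finsupp.mapDomain (rt c (ι γ * n)) x - x =
          (ρ γ (Finsupp.mapDomain (rt c n) x) - Finsupp.mapDomain (rt c n) x) + (Finsupp.mapDomain (rt c n) x - x) := by
        rw [mapDomain_rt_mul, ρ_apply]; abel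
      rw [SetLike.mem_coe, e]
      exact Submodule.add_mem _ (Submodule.mem_sup_right (Submodule.subset_span ⟨γ, _, hxn, rfl⟩))
        (Submodule.mem_sup_left (hN' n hn x hxU))
    · exact (Submodule.span_mono (subset_translates2 c S)).trans
        ((le_sup_right : Submodule.span (ZMod 2) (translates2 c S) ≤ T).trans le_sup_left)
  have key := eq_of_le_sup_aug (p := 2) hΓ ρ ρ_one ρ_mul hTU hT hU haug
  exact key.symm.le

/-! ## §3 THEOREM B: the integral forms — odd lifting, free fibre completion, `μ(G,c) = φ₂(G,c)` -/

/-- **Integral witnesses reduce to the mod-`2` coboundary hypothesis**: `f·n⁻¹ − f − 2z ∈ ℤ⟨pairs⟩ + ℤ[G]·S₀` gives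
`red f·n⁻¹ − red f ∈ pair2 + 𝔽₂⟨base changes of red S₀⟩`. [folklore] -/
theorem red_cobdry_mem_of_sub_two_smul (S₀ : Finset (CMF G c →₀ ℤ)) {n : G} {f : CMF G c →₀ ℤ} (z : CMF G c →₀ ℤ)
    (h : Finsupp.mapDomain (rt c n) f - f - (2 : ℤ) • z ∈ Submodule.span ℤ (pairSet c) ⊔ Submodule.span ℤ (translates c S₀)) :
    Finsupp.mapDomain (rt c n) (red c f) - red c f ∈
      pair2 c ⊔ Submodule.span (ZMod 2) (translates2 c (S₀.image (red c))) := by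
  have h2 : red c ((2 : ℤ) • z) = 0 := by
    ext Ψ
    rw [red_apply, Finsupp.mapRange_apply, Finsupp.smul_apply, smul_eq_mul, Int.cast_mul, Finsupp.zero_apply]
    exact zero_mul _
  have e : Finsupp.mapDomain (rt c n) (red c f) - red c f = red c (Finsupp.mapDomain (rt c n) f - f - (2 : ℤ) • z) := by
    rw [map_sub, map_sub, red_mapDomain, h2, sub_zero]
  rw [e]
  exact red_mem_psp2 c S₀ h

/-- The coboundary hypothesis stated on the integer faces `gfaceSet` (through `red`) is the hypothesis on `faces2 = red(gfaceSet)`. [folklore] -/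
theorem cobdry_faces2_of_gfaceSet (hc2 : c * c = 1) (S₀ : Finset (CMF G c →₀ ℤ)) {n : G}
    (hN : ∀ f ∈ gfaceSet G c hc2, red c (Finsupp.mapDomain (rt c n) f - f) ∈
      pair2 c ⊔ Submodule.span (ZMod 2) (translates2 c (S₀.image (red c)))) :
    ∀ f ∈ faces2 c hc2, Finsupp.mapDomain (rt c n) f - f ∈
      pair2 c ⊔ Submodule.span (ZMod 2) (translates2 c (S₀.image (red c))) := by
  rintro _ ⟨f, hf, rfl⟩
  rw [← red_mapDomain, ← map_sub]
  exact hN f hf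

/-- The coboundary hypothesis is MONOTONE in the family. [folklore] -/
theorem cobdry_mono {S₀ S : Finset (CMF G c →₀ ℤ)} (hS₀S : S₀ ⊆ S) {x : CMF G c →₀ ZMod 2}
    (hx : x ∈ pair2 c ⊔ Submodule.span (ZMod 2) (translates2 c (S₀.image (red c)))) :
    x ∈ pair2 c ⊔ Submodule.span (ZMod 2) (translates2 c (S.image (red c))) := by
  have hsub : translates2 c (S₀.image (red c)) ⊆ translates2 c (S.image (red c)) := by
    rintro _ ⟨Q, s, hs, rfl⟩
    exact ⟨Q, s, Finset.image_subset_image hS₀S hs, rfl⟩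
  have hle : pair2 c ⊔ Submodule.span (ZMod 2) (translates2 c (S₀.image (red c))) ≤
      pair2 c ⊔ Submodule.span (ZMod 2) (translates2 c (S.image (red c))) :=
    sup_le_sup_left (Submodule.span_mono hsub) _
  exact hle hx

/-- Reductions of Hodge vectors are Hodge vectors mod `2` (as a subset statement for `S₀.image red`). [folklore] -/
theorem image_red_subset_hodge2 (hc2 : c * c = 1) (S₀ : Finset (CMF G c →₀ ℤ))
    (hS₀ : (↑S₀ : Set (CMF G c →₀ ℤ)) ⊆ hodgeSpan c hc2) :
    ((S₀.image (red c) : Finset (CMF G c →₀ ZMod 2)) : Set (CMF G c →₀ ZMod 2)) ⊆ hodge2 c hc2 := by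
  intro x hx
  obtain ⟨s, hs, rfl⟩ := mem_image.mp (mem_coe.mp hx)
  exact red_mem_hodge2 c hc2 (hS₀ hs)

/-- **RELATIVE SPLITTING, integral form, fixed family.**  `G = ι(Γ)·⟨N⟩` (`Γ` a `2`-group), `c` central `≠ 1`.  A finite family `S₀` of integer
Hodge vectors whose reductions span the coinvariant fibre, whose target contains the `N`-coboundaries of all faces mod `2`, and which generates
after inverting `2`, GENERATES: `hodgeSpan ≤ ℤ⟨pairs⟩ + ℤ[G]·S₀`. [folklore] -/
theorem hodgeSpan_le_of_isPGroup_rel (hΓ : IsPGroup 2 Γ) (ι : Γ →* G) (N : Set G)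
    (hcov : ∀ Q : G, ∃ γ : Γ, ∃ n ∈ Subgroup.closure N, Q = ι γ * n)
    (hc2 : c * c = 1) (hc1 : c ≠ 1) (hcen : ∀ x : G, x * c = c * x)
    (S₀ : Finset (CMF G c →₀ ℤ)) (hS₀ : (↑S₀ : Set (CMF G c →₀ ℤ)) ⊆ hodgeSpan c hc2)
    (hfib : hodge2 c hc2 ≤ rad2 c hc2 ⊔
      Submodule.span (ZMod 2) ((S₀.image (red c) : Finset (CMF G c →₀ ZMod 2)) : Set (CMF G c →₀ ZMod 2)))
    (hN : ∀ n ∈ N, ∀ f ∈ gfaceSet G c hc2, red c (Finsupp.mapDomain (rt c n) f - f) ∈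
      pair2 c ⊔ Submodule.span (ZMod 2) (translates2 c (S₀.image (red c))))
    (k : ℕ) (htwo : ∀ y ∈ hodgeSpan c hc2,
      ((2 : ℤ) ^ k) • y ∈ Submodule.span ℤ (pairSet c) ⊔ Submodule.span ℤ (translates c S₀)) :
    hodgeSpan c hc2 ≤ Submodule.span ℤ (pairSet c) ⊔ Submodule.span ℤ (translates c S₀) := by
  have h2 := hodge2_le_of_isPGroup_rel c hΓ ι N hcov hc2 hcen (S₀.image (red c)) (image_red_subset_hodge2 c hc2 S₀ hS₀) hfib
    fun n hn => cobdry_faces2_of_gfaceSet c hc2 S₀ (hN n hn)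
  obtain ⟨m, hm, hodd⟩ := exists_odd_smul_mem_of_hodge2_le c hc2 hc1 hcen S₀ hS₀ h2
  exact generate_of_odd_smul_of_two_pow_smul c hc2 S₀ hm k hodd htwo

/-- **RELATIVE TWO-ADIC SPLITTING.**  `G = ι(Γ)·⟨N⟩` (`Γ` a `2`-group), `c` central `≠ 1`: a fibre-independent face family `S₀` whose target
contains the `N`-coboundaries of all faces mod `2` and which generates after inverting `2` extends to EXACTLY `φ₂(G,c)` faces generating
`hodgeSpan` modulo pairs — the fibre-completing faces are free. [folklore] -/
theorem exists_generate_extension_of_isPGroup_rel (hΓ : IsPGroup 2 Γ) (ι : Γ →* G) (N : Set G)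
    (hcov : ∀ Q : G, ∃ γ : Γ, ∃ n ∈ Subgroup.closure N, Q = ι γ * n)
    (hc2 : c * c = 1) (hc1 : c ≠ 1) (hcen : ∀ x : G, x * c = c * x)
    (S₀ : Finset (CMF G c →₀ ℤ)) (hS₀ : (↑S₀ : Set (CMF G c →₀ ℤ)) ⊆ gfaceSet G c hc2)
    (hli : LinearIndepOn (ZMod 2) (fun f : CMF G c →₀ ℤ => (rad2 c hc2).mkQ (red c f)) ↑S₀)
    (hN : ∀ n ∈ N, ∀ f ∈ gfaceSet G c hc2, red c (Finsupp.mapDomain (rt c n) f - f) ∈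
      pair2 c ⊔ Submodule.span (ZMod 2) (translates2 c (S₀.image (red c))))
    (k : ℕ) (htwo : ∀ y ∈ hodgeSpan c hc2,
      ((2 : ℤ) ^ k) • y ∈ Submodule.span ℤ (pairSet c) ⊔ Submodule.span ℤ (translates c S₀)) :
    ∃ S : Finset (CMF G c →₀ ℤ), S₀ ⊆ S ∧ (↑S : Set (CMF G c →₀ ℤ)) ⊆ gfaceSet G c hc2 ∧ S.card = fibreTwo c hc2 ∧
      hodgeSpan c hc2 ≤ Submodule.span ℤ (pairSet c) ⊔ Submodule.span ℤ (translates c S) := by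
  obtain ⟨S, hS₀S, hS, hcard, hle⟩ := exists_faces_extension c hc2 S₀ hS₀ hli
  have hSH : (↑S : Set (CMF G c →₀ ℤ)) ⊆ hodgeSpan c hc2 := hS.trans (gfaceSet_subset_hodgeSpan c hc2)
  have hsub : translates c S₀ ⊆ translates c S := by
    rintro _ ⟨Q, s, hs, rfl⟩
    exact ⟨Q, s, hS₀S hs, rfl⟩
  have hmono : Submodule.span ℤ (pairSet c) ⊔ Submodule.span ℤ (translates c S₀) ≤
      Submodule.span ℤ (pairSet c) ⊔ Submodule.span ℤ (translates c S) :=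
    sup_le_sup_left (Submodule.span_mono hsub) _
  exact ⟨S, hS₀S, hS, hcard, hodgeSpan_le_of_isPGroup_rel c hΓ ι N hcov hc2 hc1 hcen S hSH hle
    (fun n hn f hf => cobdry_mono c hS₀S (hN n hn f hf)) k fun y hy => hmono (htwo y hy)⟩

/-- **`μ(G,c) = φ₂(G,c)` for a factorised group `G = ι(Γ)·⟨N⟩`** from a fibre-independent face family generating after inverting `2` whose
target contains the `N`-coboundaries of the faces mod `2`. [folklore] -/
theorem isLeast_card_gfaces_generate_of_isPGroup_rel (hΓ : IsPGroup 2 Γ) (ι : Γ →* G) (N : Set G)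
    (hcov : ∀ Q : G, ∃ γ : Γ, ∃ n ∈ Subgroup.closure N, Q = ι γ * n)
    (hc2 : c * c = 1) (hc1 : c ≠ 1) (hcen : ∀ x : G, x * c = c * x)
    (S₀ : Finset (CMF G c →₀ ℤ)) (hS₀ : (↑S₀ : Set (CMF G c →₀ ℤ)) ⊆ gfaceSet G c hc2)
    (hli : LinearIndepOn (ZMod 2) (fun f : CMF G c →₀ ℤ => (rad2 c hc2).mkQ (red c f)) ↑S₀)
    (hN : ∀ n ∈ N, ∀ f ∈ gfaceSet G c hc2, red c (Finsupp.mapDomain (rt c n) f - f) ∈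
      pair2 c ⊔ Submodule.span (ZMod 2) (translates2 c (S₀.image (red c))))
    (k : ℕ) (htwo : ∀ y ∈ hodgeSpan c hc2,
      ((2 : ℤ) ^ k) • y ∈ Submodule.span ℤ (pairSet c) ⊔ Submodule.span ℤ (translates c S₀)) :
    IsLeast {n : ℕ | ∃ S : Finset (CMF G c →₀ ℤ), (↑S ⊆ gfaceSet G c hc2) ∧ S.card = n ∧
      hodgeSpan c hc2 ≤ Submodule.span ℤ (pairSet c) ⊔ Submodule.span ℤ (translates c S)} (fibreTwo c hc2) := by
  refine ⟨?_, ?_⟩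
  · obtain ⟨S, -, hS, hcard, hgen⟩ :=
      exists_generate_extension_of_isPGroup_rel c hΓ ι N hcov hc2 hc1 hcen S₀ hS₀ hli hN k htwo
    exact ⟨S, hS, hcard, hgen⟩
  · rintro n ⟨S, hS, rfl, hgen⟩
    exact fibreTwo_le_card_of_faces c hc2 hcen S hS fun y hy => hgen (gfaceSet_subset_hodgeSpan c hc2 hy)

/-- **Upper bound form** `μ(G,c) ≤ φ₂(G,c)` as a bare existence statement (the family found contains `S₀`). [folklore] -/
theorem exists_gfaces_generate_card_eq_fibreTwo_of_isPGroup_rel (hΓ : IsPGroup 2 Γ) (ι : Γ →* G) (N : Set G)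
    (hcov : ∀ Q : G, ∃ γ : Γ, ∃ n ∈ Subgroup.closure N, Q = ι γ * n)
    (hc2 : c * c = 1) (hc1 : c ≠ 1) (hcen : ∀ x : G, x * c = c * x)
    (S₀ : Finset (CMF G c →₀ ℤ)) (hS₀ : (↑S₀ : Set (CMF G c →₀ ℤ)) ⊆ gfaceSet G c hc2)
    (hli : LinearIndepOn (ZMod 2) (fun f : CMF G c →₀ ℤ => (rad2 c hc2).mkQ (red c f)) ↑S₀)
    (hN : ∀ n ∈ N, ∀ f ∈ gfaceSet G c hc2, red c (Finsupp.mapDomain (rt c n) f - f) ∈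
      pair2 c ⊔ Submodule.span (ZMod 2) (translates2 c (S₀.image (red c))))
    (k : ℕ) (htwo : ∀ y ∈ hodgeSpan c hc2,
      ((2 : ℤ) ^ k) • y ∈ Submodule.span ℤ (pairSet c) ⊔ Submodule.span ℤ (translates c S₀)) :
    ∃ S : Finset (CMF G c →₀ ℤ), (↑S : Set (CMF G c →₀ ℤ)) ⊆ gfaceSet G c hc2 ∧ S.card = fibreTwo c hc2 ∧
      hodgeSpan c hc2 ≤ Submodule.span ℤ (pairSet c) ⊔ Submodule.span ℤ (translates c S) := by
  obtain ⟨S, -, hS, hcard, hgen⟩ :=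
    exists_generate_extension_of_isPGroup_rel c hΓ ι N hcov hc2 hc1 hcen S₀ hS₀ hli hN k htwo
  exact ⟨S, hS, hcard, hgen⟩

/-! ## §4 The subgroup form of the factorisation (`Γ = P ≤ G` a `2`-subgroup, `G = P·⟨N⟩`) -/

/-- **Subgroup form of Theorem A**: `P ≤ G` a `2`-subgroup with `G = P·⟨N⟩`. [folklore] -/
theorem hodge2_le_of_isPGroup_subgroup (P : Subgroup G) (hP : IsPGroup 2 P) (N : Set G)
    (hcov : ∀ Q : G, ∃ p ∈ P, ∃ n ∈ Subgroup.closure N, Q = p * n)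
    (hc2 : c * c = 1) (hcen : ∀ x : G, x * c = c * x)
    (S : Finset (CMF G c →₀ ZMod 2)) (hS : (S : Set (CMF G c →₀ ZMod 2)) ⊆ hodge2 c hc2)
    (h : hodge2 c hc2 ≤ rad2 c hc2 ⊔ Submodule.span (ZMod 2) (S : Set (CMF G c →₀ ZMod 2)))
    (hN : ∀ n ∈ N, ∀ f ∈ faces2 c hc2,
      Finsupp.mapDomain (rt c n) f - f ∈ pair2 c ⊔ Submodule.span (ZMod 2) (translates2 c S)) :
    hodge2 c hc2 ≤ pair2 c ⊔ Submodule.span (ZMod 2) (translates2 c S) :=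
  hodge2_le_of_isPGroup_rel c hP P.subtype N
    (fun Q => by
      obtain ⟨p, hp, n, hn, rfl⟩ := hcov Q
      exact ⟨⟨p, hp⟩, n, hn, rfl⟩)
    hc2 hcen S hS h hN

/-- **Subgroup form of `μ(G,c) = φ₂(G,c)`**: `P ≤ G` a `2`-subgroup with `G = P·⟨N⟩`. [folklore] -/
theorem isLeast_card_gfaces_generate_of_isPGroup_subgroup (P : Subgroup G) (hP : IsPGroup 2 P) (N : Set G)
    (hcov : ∀ Q : G, ∃ p ∈ P, ∃ n ∈ Subgroup.closure N, Q = p * n)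
    (hc2 : c * c = 1) (hc1 : c ≠ 1) (hcen : ∀ x : G, x * c = c * x)
    (S₀ : Finset (CMF G c →₀ ℤ)) (hS₀ : (↑S₀ : Set (CMF G c →₀ ℤ)) ⊆ gfaceSet G c hc2)
    (hli : LinearIndepOn (ZMod 2) (fun f : CMF G c →₀ ℤ => (rad2 c hc2).mkQ (red c f)) ↑S₀)
    (hN : ∀ n ∈ N, ∀ f ∈ gfaceSet G c hc2, red c (Finsupp.mapDomain (rt c n) f - f) ∈
      pair2 c ⊔ Submodule.span (ZMod 2) (translates2 c (S₀.image (red c))))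
    (k : ℕ) (htwo : ∀ y ∈ hodgeSpan c hc2,
      ((2 : ℤ) ^ k) • y ∈ Submodule.span ℤ (pairSet c) ⊔ Submodule.span ℤ (translates c S₀)) :
    IsLeast {n : ℕ | ∃ S : Finset (CMF G c →₀ ℤ), (↑S ⊆ gfaceSet G c hc2) ∧ S.card = n ∧
      hodgeSpan c hc2 ≤ Submodule.span ℤ (pairSet c) ⊔ Submodule.span ℤ (translates c S)} (fibreTwo c hc2) :=
  isLeast_card_gfaces_generate_of_isPGroup_rel c hP P.subtype N
    (fun Q => by
      obtain ⟨p, hp, n, hn, rfl⟩ := hcov Q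
      exact ⟨⟨p, hp⟩, n, hn, rfl⟩)
    hc2 hc1 hcen S₀ hS₀ hli hN k htwo

end Rel

end

end Summit.HodgeConjecture.CorCM.Census.Splitting
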